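import Mathlib

/-!
# `MatrixDescartes` census — the SLOPE / ABEL step of chamber-uniform certificates (pure real inequalities)

HONEST FRAMING.  Object-search cell `pub-symmetroid`, door-A target `DoorA26 := PosRootLawAt 2 6 19`
(stmt-ValiantsHypothesis-19979; OPEN, typed, never asserted), crux `Theses.LacunarySymmetroid.MatrixDescartes`
(stmt-ValiantsHypothesis-18050).  Theory g6's slope form of the Newton-cone rows (UNIFORM-NC-SLOPE-g6 §1, Lemmas 1–2 and
the Proposition) is what makes a `V = 20` certificate UNIFORM over a chamber: with `a_t` the Newton-normalised log-coefficients
at positions `E_0 < ⋯ < E_n`, the C25 rows say that the slopes `σ_r = (a_r − a_{r−1})/(E_r − E_{r−1})` decrease, and a balanced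
geometry row `Σ_t A_t a_t ≥ κ` becomes, by Abel summation, `Σ_s U_s (σ_s − σ_{s+1}) ≥ κ` with `U_s = Σ_{r≤s} (E_r − E_{r−1}) Ā_r`,
`Ā_r = Σ_{t≥r} A_t`; if every `U_s ≤ 0` on the chamber then `κ ≤ 0`.  This file proves that step once, as elementary
statements about real sequences indexed by `ℕ` (no pencils, no exponents):

* `abel_range` — Abel summation `Σ_{r<m} σ_{r+1}(U_{r+1} − U_r) = σ_m U_m + Σ_{r<m} U_r(σ_r − σ_{r+1})` (`U_0 = 0`);
* `slope_sum_nonpos` — decreasing `σ`, `U_r ≤ 0`, `U_0 = U_n = 0` ⇒ that sum is `≤ 0`;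
* **`newton_abel_nonpos`** — from the Newton rows in their kernel shape
  (`(E_{s+1} − E_s) a_{s−1} + (E_s − E_{s−1}) a_{s+1} ≤ (E_{s+1} − E_{s−1}) a_s`, cf. `Census.chamber_newton_cone_log`) and the
  partial-sum conditions `U_s ≤ 0` (`s < n`), `U_n = 0`: `Σ_{r<n} (a_{r+1} − a_r) Ā_{r+1} ≤ 0` — the form a per-chamber
  certificate file reduces its geometry row to (with its concrete `A`, `Σ_t A_t a_t = Σ_r (a_{r+1} − a_r) Ā_{r+1}` is `ring`).

Nothing here mentions pencils; nothing bears on any census row, on `DoorA26` (OPEN), on the crux, or on `VP ≠ VNP`.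

[folklore] Abel summation and monotone slopes; elementary.
-/

-- `Summit.ValiantsHypothesis.ValiantsHypothesis.…` repeats a component by the D-0017 layout
-- (single-conjunct summit), which the `dupNamespace` linter flags; the name is mandated.
set_option linter.dupNamespace false

namespace Summit.ValiantsHypothesis.ValiantsHypothesis.Theorems.LacunarySymmetroidMatrixDescartes.Census

open Finset
open scoped BigOperators

/-- **Abel summation** (range form, `U 0 = 0`):
`Σ_{r<m} σ(r+1)·(U(r+1) − U r) = σ m · U m + Σ_{r<m} U r · (σ r − σ (r+1))`. [folklore] -/
theorem abel_range (σ U : ℕ → ℝ) (hU0 : U 0 = 0) (m : ℕ) :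
    ∑ r ∈ range m, σ (r + 1) * (U (r + 1) - U r) = σ m * U m + ∑ r ∈ range m, U r * (σ r - σ (r + 1)) := by
  induction m with
  | zero => simp [hU0]
  | succ m ih =>
    rw [sum_range_succ, sum_range_succ, ih]
    ring

/-- **Monotone slopes against non-positive partial sums**: if `σ (r+1) ≤ σ r` for `0 < r < n`, `U r ≤ 0` for `r < n`, and
`U 0 = U n = 0`, then `Σ_{r<n} σ(r+1)·(U(r+1) − U r) ≤ 0`. [folklore] -/
theorem slope_sum_nonpos (n : ℕ) (σ U : ℕ → ℝ) (hU0 : U 0 = 0) (hUn : U n = 0) (hU : ∀ r, r < n → U r ≤ 0)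
    (hσ : ∀ r, 0 < r → r < n → σ (r + 1) ≤ σ r) :
    ∑ r ∈ range n, σ (r + 1) * (U (r + 1) - U r) ≤ 0 := by
  rw [abel_range σ U hU0 n, hUn, mul_zero, zero_add]
  apply sum_nonpos
  intro r hr
  rw [mem_range] at hr
  rcases Nat.eq_zero_or_pos r with h0 | hpos
  · subst h0; rw [hU0]; simp
  · exact mul_nonpos_of_nonpos_of_nonneg (hU r hr) (sub_nonneg.mpr (hσ r hpos hr))

/-- **The Newton–Abel step of a chamber-uniform certificate.**  Let `E 0 < E 1 < ⋯ < E n` and let `a` satisfy the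
Newton-cone rows `(E(s+1) − E s)·a(s−1) + (E s − E(s−1))·a(s+1) ≤ (E(s+1) − E(s−1))·a s` for `0 < s < n` (concavity of
`(E s, a s)`).  Let `Ā : ℕ → ℝ` (the tail sums of a balanced row) have partial sums
`U s = Σ_{r<s} (E(r+1) − E r)·Ā(r+1) ≤ 0` for all `s < n` and `U n = 0`.  Then `Σ_{r<n} (a(r+1) − a r)·Ā(r+1) ≤ 0`.
Proof: slopes `σ r = (a r − a(r−1))/(E r − E(r−1))` decrease; `(a(r+1) − a r)Ā(r+1) = σ(r+1)(U(r+1) − U r)`; Abel. [folklore] -/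
theorem newton_abel_nonpos (n : ℕ) (a E Abar : ℕ → ℝ) (hE : ∀ r, r < n → E r < E (r + 1))
    (hN : ∀ s, 0 < s → s < n →
      (E (s + 1) - E s) * a (s - 1) + (E s - E (s - 1)) * a (s + 1) ≤ (E (s + 1) - E (s - 1)) * a s)
    (hU : ∀ s, s < n → ∑ r ∈ range s, (E (r + 1) - E r) * Abar (r + 1) ≤ 0)
    (hUn : ∑ r ∈ range n, (E (r + 1) - E r) * Abar (r + 1) = 0) :
    ∑ r ∈ range n, (a (r + 1) - a r) * Abar (r + 1) ≤ 0 := by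
  set σ : ℕ → ℝ := fun r => (a r - a (r - 1)) / (E r - E (r - 1)) with hσdef
  set U : ℕ → ℝ := fun s => ∑ r ∈ range s, (E (r + 1) - E r) * Abar (r + 1) with hUdef
  have hU0 : U 0 = 0 := by simp [hUdef]
  have hstep : ∀ r, r < n → (a (r + 1) - a r) * Abar (r + 1) = σ (r + 1) * (U (r + 1) - U r) := by
    intro r hr
    have hg : 0 < E (r + 1) - E r := sub_pos.mpr (hE r hr)
    have hUdiff : U (r + 1) - U r = (E (r + 1) - E r) * Abar (r + 1) := by
      simp only [hUdef, sum_range_succ]; ring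
    have hσr : σ (r + 1) * (E (r + 1) - E r) = a (r + 1) - a r := by
      simp only [hσdef, Nat.add_sub_cancel]
      exact div_mul_cancel₀ _ hg.ne'
    rw [hUdiff, ← mul_assoc, hσr]
  have hmono : ∀ r, 0 < r → r < n → σ (r + 1) ≤ σ r := by
    intro r hr0 hrn
    have hg1 : 0 < E (r + 1) - E r := sub_pos.mpr (hE r hrn)
    have hg0 : 0 < E r - E (r - 1) := by
      have := hE (r - 1) (by omega)
      rw [Nat.sub_add_cancel hr0] at this
      exact sub_pos.mpr this
    have hNs := hN r hr0 hrn
    simp only [hσdef, Nat.add_sub_cancel]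
    rw [div_le_div_iff₀ hg1 hg0]
    nlinarith [hNs]
  calc ∑ r ∈ range n, (a (r + 1) - a r) * Abar (r + 1)
      = ∑ r ∈ range n, σ (r + 1) * (U (r + 1) - U r) := sum_congr rfl fun r hr => hstep r (mem_range.mp hr)
    _ ≤ 0 := slope_sum_nonpos n σ U hU0 (by simpa [hUdef] using hUn) (fun r hr => by simpa [hUdef] using hU r hr) hmono

end Summit.ValiantsHypothesis.ValiantsHypothesis.Theorems.LacunarySymmetroidMatrixDescartes.Census
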